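import Literature.NumberTheory.LFunctions.ZetaConvexityExplicit
import Literature.NumberTheory.LFunctions.EulerMaclaurinZeta
import Literature.NumberTheory.LFunctions.LehmanCriticalLineBound
import Literature.NumberTheory.LFunctions.TuringMethod
import Literature.NumberTheory.LFunctions.TuringLowerBound
import Literature.NumberTheory.LFunctions.BookerLemmaProofs
import Literature.NumberTheory.LFunctions.LogZetaConvex
import Literature.NumberTheory.LFunctions.LevinsonMontgomeryBacklund
import Mathlib.Analysis.SumIntegralComparisons
import Mathlib.Analysis.SpecialFunctions.Log.Monotone
import Mathlib.NumberTheory.ZetaValues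
import HarnessLib

/-!
# Turing's bound `|∫_{t₁}^{t₂} S(t) dt| ≤ 2.30 + 0.128 log(t₂/2π)` (Edwards §8.2 (1)): proof

Topic `Literature/NumberTheory/LFunctions` (trunk T-ANT, family RH).  Companion of `TuringMethod.lean`:
the **discharge** `abs_integral_zetaArgS_le_turing_holds` of the named fact
`Literature.NumberTheory.LFunctions.abs_integral_zetaArgS_le_turing` ([EdwardsZeta1974, §8.2 (1)];
Turing 1953, Thm 4; Lehman 1970, Thm 4): `|∫_{t₁}^{t₂} S(t) dt| ≤ 2.30 + 0.128 log(t₂/2π)` for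
`168π < t₁ < t₂`.  The proof follows Lehman's repair of Turing's argument in the form of
Trudgian 2011, §2 (whose sharper Theorem 2.2 implies the target), on top of the tree's
infrastructure: Turing's lemma `π∫_{t₁}^{t₂} S = U(t₂) − U(t₁)`, `U(t) = ∫_{1/2}^∞ log|ζ(σ+it)| dσ`
(`Literature.NumberTheory.LFunctions.pi_mul_integral_zetaArgS_eq`, `ZetaArgVariation.lean`), the
explicit convexity bound and the assembly of [Trudgian2011, Thm 2.12]
(`ZetaConvexityExplicit.lean`), the lower bound [Trudgian2011, Lemma 2.11]
(`Literature.NumberTheory.LFunctions.neg_setIntegral_Ioi_half_log_norm_riemannZeta_le'`,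
`TuringLowerBound.lean`) and Booker's lemma
(`Literature.NumberTheory.LFunctions.Trudgian2011_lemma_2_10_holds`, `BookerLemmaProofs.lean`).
Because Turing's constants are much looser than Trudgian's (`0.128` vs `0.059`), the
Riemann–Siegel input `|ζ(½+it)| ≤ 2.53 t^{1/4}` of [Trudgian2011, Lemma 2.5] (an unproved named fact
of `LehmanCriticalLineBound.lean`) is replaced by an elementary all-`t` bound of exponent `½`
proved here, and all numerical constants can be certified by crude rational arithmetic.
Everything in this file is proved; there are no named facts and no definitions.

## Contents

* `norm_riemannZeta_half_line_le_three_sqrt_floor` — for `|u| ≥ 1`, `N = ⌊|u|⌋`: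
  `|ζ(½+iu)| ≤ 3√N + 3` (Euler–Maclaurin of order `0`,
  `Literature.NumberTheory.LFunctions.riemannZeta_eq_eulerMaclaurin₀`, [EdwardsZeta1974, §6.4]).
* `norm_riemannZeta_half_line_le_four_mul_rpow_half` — **for all real `u`**:
  `|ζ(½+iu)| ≤ 4 |10 + ½ + iu|^{1/2}`, i.e. the hypothesis `hline` of
  `Literature.NumberTheory.LFunctions.setIntegral_Ioi_half_log_norm_riemannZeta_le'` with
  `K = 4`, `θ = ½`, `Q = 10`.
* `setIntegral_Ioi_half_log_norm_riemannZeta_le_turing` — the resulting upper bound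
  `U(t) ≤ [∫_c^∞ log ζ + ½(c−½) log(4ζ(c)) + (5/4)(c−½)(10+c)²/(2t₀²)] + ((c−½)/4) log t`
  (`c > 1`, `1 ≤ t₀ < t`, `t` not an ordinate).
* `abs_integral_zetaArgS_le_turing_of_bounds` — **the reduction**: bounds `U(t) ≤ a₁ + b₁ log t`,
  `−U(t) ≤ a₂ + b₂ log t` for the non-ordinates `t > 168π` together with the two numerical
  inequalities `(b₁+b₂)/π ≤ 0.128`,
  `(a₁+a₂)/π + ((b₁+b₂)/π) log(168π) ≤ 2.30 + 0.128 (log(168π) − log 2π)` imply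
  `abs_integral_zetaArgS_le_turing`.
* Numerics on the real axis (`σ > 1`): the integral tests
  `re_riemannZeta_ofReal_le_sum_add` / `sum_add_le_re_riemannZeta_ofReal`
  (`Σ_{n≤N} n^{-σ} + (N+1)^{1−σ}/(σ−1) ≤ ζ(σ) ≤ Σ_{n≤N} n^{-σ} + N^{1−σ}/(σ−1)`), the trapezoid rule
  for the convex `log ζ` (`intervalIntegral_log_norm_riemannZeta_ofReal_le_trapezoid`, from
  `Literature.NumberTheory.LFunctions.convexOn_log_re_riemannZeta`), the tail
  `∫_{σ₁}^∞ log ζ ≤ (1 + 2/(σ₁−1)) 2^{−σ₁}/log 2` (`setIntegral_Ioi_log_norm_riemannZeta_ofReal_le_tail`),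
  and (namespace `TuringBound`) certified decimal values: `log ζ` at `5/4, 3/2, 2, …, 5`,
  `∫_{3/2}^∞ log ζ ≤ 0.947`, `∫_{5/4}^∞ log ζ ≤ 1.263`, `‖ζ'(3/2)‖ ≤ 4.035`, `ζ(3/2) ≥ 2.5654`,
  `−ζ'/ζ(3/2) ≤ 1.573`, `log 2π ∈ [1.8378, 1.8379]`, `log(168π) ≥ 6.2686`, and the constants
  `a₁ ≤ 2.362` (`c = 5/4`), `a₂ = trudgianA₂ 1 (168π) ≤ 3.348`, `b₂ = trudgianB₂ 1 ≤ 0.1932`.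
* `abs_integral_zetaArgS_le_turing_holds` — **the discharge**, with `c = 5/4`, `d = 1`
  (Booker's original lemma), `t₀ = 168π`: `(3/16 + b₂)/π ≤ 0.1212 < 0.128` and
  `(a₁ + a₂)/π ≤ 1.818 < 2.30 − 0.128 log 2π = 2.0647…`.

## References

* H. M. Edwards, *Riemann's Zeta Function*, Academic Press 1974, §6.4 eq. (1), §8.2 eq. (1).
  [EdwardsZeta1974]
* A. M. Turing, *Some calculations of the Riemann zeta-function*, Proc. LMS (3) 3 (1953), Thm 4,
  Lemmas 1–9.  [Turing1953]
* R. S. Lehman, *On the distribution of zeros of the Riemann zeta-function*, Proc. LMS (3) 20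
  (1970), §§4–5.  [Lehman1970]
* T. S. Trudgian, *Improvements to Turing's method*, Math. Comp. 80 (2011), §2.2, Lemmas 2.4–2.12,
  Thm 2.2.  [Trudgian2011]
-/

noncomputable section

open Complex Real Set MeasureTheory Filter Topology intervalIntegral
open scoped Real

namespace Literature.NumberTheory.LFunctions

/-! ### An all-`t` bound on the critical line from the Euler–Maclaurin formula of order `0` -/

/-- `∑_{n=1}^X n^{-1/2} ≤ 2√X`. [folklore] -/
private theorem sum_Icc_rpow_neg_half_le_two_sqrt (X : ℕ) :
    ∑ n ∈ Finset.Icc 1 X, (n : ℝ) ^ (-(1 / 2 : ℝ)) ≤ 2 * Real.sqrt X := by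
  induction X with
  | zero => simp
  | succ X ih =>
    rw [Finset.sum_Icc_succ_top (by omega)]
    have hX : (0 : ℝ) ≤ X := Nat.cast_nonneg X
    have hsq : Real.sqrt X ≤ Real.sqrt (X + 1) := Real.sqrt_le_sqrt (by linarith)
    have hpos : 0 < Real.sqrt ((X : ℝ) + 1) := Real.sqrt_pos.2 (by linarith)
    have hterm : ((X + 1 : ℕ) : ℝ) ^ (-(1 / 2 : ℝ)) = (Real.sqrt (X + 1))⁻¹ := by
      push_cast
      rw [Real.rpow_neg (by linarith), ← Real.sqrt_eq_rpow]
    rw [hterm]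
    have hprod : (Real.sqrt (X + 1) - Real.sqrt X) * (Real.sqrt (X + 1) + Real.sqrt X) = 1 := by
      have h1 : Real.sqrt (X + 1) ^ 2 = X + 1 := Real.sq_sqrt (by linarith)
      have h2 : Real.sqrt X ^ 2 = X := Real.sq_sqrt hX
      nlinarith
    have hkey : (Real.sqrt (X + 1))⁻¹ ≤ 2 * (Real.sqrt (X + 1) - Real.sqrt X) := by
      rw [inv_le_iff_one_le_mul₀ hpos]
      nlinarith [Real.sqrt_nonneg X]
    push_cast
    linarith

/-- **Euler–Maclaurin on the critical line, explicit**: for `|u| ≥ 1` and `N = ⌊|u|⌋`,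
`|ζ(½ + iu)| ≤ 3√N + 3`. From `ζ(s) = Σ_{n<N} n^{-s} + N^{1-s}/(s−1) + ½N^{-s} − s∫_N^∞ B̄₁(x)x^{-s-1}dx`
(`Literature.NumberTheory.LFunctions.riemannZeta_eq_eulerMaclaurin₀`, Edwards §6.4) with
`Σ_{n≤N} n^{-1/2} ≤ 2√N`, `|N^{1-s}/(s−1)| ≤ √N/|u| ≤ 1`, `|s| N^{-1/2} ≤ (N + 3/2)/√N`.
[cite: EdwardsZeta1974, §6.4 eq. (1)] -/
theorem norm_riemannZeta_half_line_le_three_sqrt_floor {u : ℝ} (hu : 1 ≤ |u|) :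
    ‖riemannZeta (1 / 2 + u * I)‖ ≤ 3 * Real.sqrt ⌊|u|⌋₊ + 3 := by
  set N : ℕ := ⌊|u|⌋₊ with hNdef
  have hN1 : 1 ≤ N := Nat.le_floor (by simpa using hu)
  have hNle : (N : ℝ) ≤ |u| := Nat.floor_le (abs_nonneg u)
  have hltN : |u| < N + 1 := Nat.lt_floor_add_one |u|
  have hNpos : (0 : ℝ) < N := by exact_mod_cast hN1
  have hN1r : (1 : ℝ) ≤ N := by exact_mod_cast hN1
  have hsq0 : 0 < Real.sqrt N := Real.sqrt_pos.2 hNpos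
  have hsq1 : 1 ≤ Real.sqrt N := by
    rw [show (1 : ℝ) = Real.sqrt 1 by simp]
    exact Real.sqrt_le_sqrt hN1r
  have hsqsq : Real.sqrt N * Real.sqrt N = N := Real.mul_self_sqrt hNpos.le
  set s : ℂ := 1 / 2 + u * I with hs
  have hre : s.re = 1 / 2 := by simp [hs]
  have him : s.im = u := by simp [hs]
  have hs1 : s ≠ 1 := by
    intro h; have := congrArg Complex.re h; rw [hre] at this; norm_num at this
  have hσ : 0 < s.re := by rw [hre]; norm_num
  have hEM := riemannZeta_eq_eulerMaclaurin₀ hN1 hσ hs1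
  have hnorm_s : ‖s‖ ≤ 1 / 2 + |u| := by
    have := Complex.norm_le_abs_re_add_abs_im s
    rw [hre, him] at this
    norm_num at this
    exact this
  have hrpow_neg : (N : ℝ) ^ (-(1 / 2 : ℝ)) = (Real.sqrt N)⁻¹ := by
    rw [Real.rpow_neg hNpos.le, ← Real.sqrt_eq_rpow]
  -- (1) the partial sum
  have h1 : ‖∑ n ∈ Finset.Ico 1 N, (n : ℂ) ^ (-s)‖ ≤ 2 * Real.sqrt N := by
    refine (norm_sum_le _ _).trans ?_
    have hterm : ∀ n ∈ Finset.Ico 1 N, ‖(n : ℂ) ^ (-s)‖ = (n : ℝ) ^ (-(1 / 2 : ℝ)) := by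
      intro n hn
      have hn0 : 0 < n := (Finset.mem_Ico.1 hn).1
      rw [Complex.norm_natCast_cpow_of_pos hn0]
      simp [hre]
    rw [Finset.sum_congr rfl hterm]
    refine le_trans ?_ (sum_Icc_rpow_neg_half_le_two_sqrt N)
    refine Finset.sum_le_sum_of_subset_of_nonneg (fun n hn ↦ ?_) (fun n _ _ ↦ by positivity)
    rw [Finset.mem_Ico] at hn; rw [Finset.mem_Icc]; omega
  -- (2) the term `N^{1-s}/(s-1)`
  have h2 : ‖(N : ℂ) ^ (1 - s) / (s - 1)‖ ≤ 1 := by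
    have hnum : ‖(N : ℂ) ^ (1 - s)‖ = Real.sqrt N := by
      rw [Complex.norm_natCast_cpow_of_pos (by omega : 0 < N), Real.sqrt_eq_rpow]
      congr 1; simp [hre]; norm_num
    have hden : |u| ≤ ‖s - 1‖ := by
      have := Complex.abs_im_le_norm (s - 1)
      simpa [him] using this
    have hden0 : 0 < ‖s - 1‖ := lt_of_lt_of_le (by linarith) hden
    rw [norm_div, hnum, div_le_one hden0]
    -- `√N ≤ N ≤ |u| ≤ ‖s - 1‖`
    have : Real.sqrt N ≤ N := by nlinarith
    linarith
  -- (3) the term `N^{-s}/2`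
  have h3 : ‖(N : ℂ) ^ (-s) / 2‖ ≤ 1 / 2 := by
    have hnum : ‖(N : ℂ) ^ (-s)‖ = (Real.sqrt N)⁻¹ := by
      rw [Complex.norm_natCast_cpow_of_pos (by omega : 0 < N), ← hrpow_neg]
      congr 1; simp [hre]
    rw [norm_div, hnum]
    have : (Real.sqrt N)⁻¹ ≤ 1 := inv_le_one_of_one_le₀ hsq1
    have h2' : ‖(2 : ℂ)‖ = 2 := by norm_num
    rw [h2']
    linarith
  -- (4) the remainder `s ∫_N^∞ B̄₁(x) x^{-s-1} dx`
  have h4 : ‖s * bernoulliIntegral 1 N s‖ ≤ Real.sqrt N + 3 / 2 := by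
    have hB := norm_bernoulliLogIntegral_zero_le (k := 1) (N := N) abs_bernoulliPer_one_le hN1
      (s := s) (by rw [hre]; norm_num)
    rw [bernoulliLogIntegral_zero] at hB
    have hB' : ‖bernoulliIntegral 1 N s‖ ≤ (Real.sqrt N)⁻¹ := by
      refine hB.trans (le_of_eq ?_)
      rw [hre, ← hrpow_neg]
      norm_num
      ring
    rw [norm_mul]
    have hprod : ‖s‖ * ‖bernoulliIntegral 1 N s‖ ≤ (1 / 2 + |u|) * (Real.sqrt N)⁻¹ :=
      mul_le_mul hnorm_s hB' (norm_nonneg _) (by positivity)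
    refine hprod.trans ?_
    rw [← div_eq_mul_inv, div_le_iff₀ hsq0]
    nlinarith
  -- assemble
  rw [hEM]
  calc ‖∑ n ∈ Finset.Ico 1 N, (n : ℂ) ^ (-s) + (N : ℂ) ^ (1 - s) / (s - 1) + (N : ℂ) ^ (-s) / 2 -
        s * bernoulliIntegral 1 N s‖
      ≤ ‖∑ n ∈ Finset.Ico 1 N, (n : ℂ) ^ (-s)‖ + ‖(N : ℂ) ^ (1 - s) / (s - 1)‖ +
          ‖(N : ℂ) ^ (-s) / 2‖ + ‖s * bernoulliIntegral 1 N s‖ := by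
        refine (norm_sub_le _ _).trans ?_
        gcongr
        exact (norm_add_le _ _).trans (by gcongr; exact norm_add_le _ _)
    _ ≤ 2 * Real.sqrt N + 1 + 1 / 2 + (Real.sqrt N + 3 / 2) := by gcongr
    _ = 3 * Real.sqrt N + 3 := by ring

/-- **All-`t` critical-line bound of exponent `½`**: for every real `u`,
`|ζ(½ + iu)| ≤ 4 · |10 + ½ + iu|^{1/2}` — the hypothesis `hline` of the explicit convexity
estimate `Literature.NumberTheory.LFunctions.setIntegral_Ioi_half_log_norm_riemannZeta_le'` with
`K = 4`, `θ = ½`, `Q = 10` (for `|u| ≥ 1`: `3√⌊|u|⌋ + 3 ≤ 3√M + √M`, `M = |21/2 + iu| ≥ 9`; for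
`|u| ≤ 1`: `|ζ| ≤ 1 + √5`, `Literature.NumberTheory.LFunctions.norm_riemannZeta_half_line_le_of_abs_le_one`).
[folklore] -/
theorem norm_riemannZeta_half_line_le_four_mul_rpow_half (u : ℝ) :
    ‖riemannZeta (1 / 2 + u * I)‖ ≤ 4 * ‖((10 : ℝ) : ℂ) + (1 / 2 + u * I)‖ ^ (1 / 2 : ℝ) := by
  set M : ℝ := ‖((10 : ℝ) : ℂ) + (1 / 2 + u * I)‖ with hM
  have hre' : (((10 : ℝ) : ℂ) + (1 / 2 + u * I)).re = 21 / 2 := by simp; norm_num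
  have him' : (((10 : ℝ) : ℂ) + (1 / 2 + u * I)).im = u := by simp
  have hMu : |u| ≤ M := by
    have h1 := Complex.abs_im_le_norm (((10 : ℝ) : ℂ) + (1 / 2 + u * I))
    rwa [him'] at h1
  have hM21 : (21 / 2 : ℝ) ≤ M := by
    have h1 := Complex.abs_re_le_norm (((10 : ℝ) : ℂ) + (1 / 2 + u * I))
    rwa [hre', abs_of_pos (by norm_num)] at h1
  have hM0 : 0 ≤ M := norm_nonneg _
  rw [← Real.sqrt_eq_rpow M]
  have h3 : 3 ≤ Real.sqrt M := by
    rw [show (3 : ℝ) = Real.sqrt 9 by rw [show (9 : ℝ) = 3 ^ 2 by norm_num, Real.sqrt_sq (by norm_num)]]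
    exact Real.sqrt_le_sqrt (by linarith)
  rcases le_or_gt 1 |u| with hu | hu
  · have h := norm_riemannZeta_half_line_le_three_sqrt_floor hu
    have hN : Real.sqrt ⌊|u|⌋₊ ≤ Real.sqrt M :=
      Real.sqrt_le_sqrt ((Nat.floor_le (abs_nonneg u)).trans hMu)
    linarith
  · have h := norm_riemannZeta_half_line_le_of_abs_le_one hu.le
    have h5 : Real.sqrt 5 ≤ 3 := by
      rw [show (3 : ℝ) = Real.sqrt 9 by rw [show (9 : ℝ) = 3 ^ 2 by norm_num, Real.sqrt_sq (by norm_num)]]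
      exact Real.sqrt_le_sqrt (by norm_num)
    linarith

/-! ### The upper bound for `∫_{1/2}^∞ log|ζ(σ+it)| dσ` with `K = 4`, `θ = ½`, `Q = 10` -/

/-- **Upper bound for `U(t) = ∫_{1/2}^∞ log|ζ(σ+it)| dσ`** (Turing 1953, Lemma 5 / Lehman 1970 /
Trudgian 2011, Lemma 2.8, with the elementary exponent `θ = ½` on the critical line): for `c > 1`,
`1 ≤ t₀ < t`, `t` not an ordinate,
`U(t) ≤ [∫_c^∞ log ζ(σ)dσ + ½(c−½) log(4ζ(c)) + (5/4)(c−½)(10+c)²/(2t₀²)] + ((c−½)/4) log t`.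
[cite: Trudgian2011, Lemma 2.8] -/
theorem setIntegral_Ioi_half_log_norm_riemannZeta_le_turing {c t₀ t : ℝ} (hc : 1 < c)
    (ht₀ : 1 ≤ t₀) (ht : t₀ < t) (hord : ∀ ρ : ℂ, riemannZeta ρ = 0 → ρ.im ≠ t) :
    ∫ σ in Ioi (1 / 2 : ℝ), Real.log ‖riemannZeta (σ + t * I)‖ ≤
      ((∫ σ in Ioi c, Real.log ‖riemannZeta σ‖) + (c - 1 / 2) / 2 * Real.log (4 * (riemannZeta c).re)
        + (1 / 2 * ((c - 1 / 2) / 2) + (c - 1 / 2)) * ((10 + c) ^ 2 / (2 * t₀ ^ 2)))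
      + 1 / 2 * ((c - 1 / 2) / 2) * Real.log t :=
  setIntegral_Ioi_half_log_norm_riemannZeta_le' (K := 4) (θ := 1 / 2) (Q := 10) (by norm_num)
    (by norm_num) (by norm_num) hc ht₀ norm_riemannZeta_half_line_le_four_mul_rpow_half ht hord

/-! ### Assembly: Turing's bound from the two bounds for `∫ log|ζ|` and two numerical inequalities -/

/-- **Turing's bound from bounds for `U(t) = ∫_{1/2}^∞ log|ζ(σ+it)| dσ`.** If for the non-ordinates
`t > 168π` one has `U(t) ≤ a₁ + b₁ log t` and `−U(t) ≤ a₂ + b₂ log t` (`b₁, b₂ ≥ 0`), and the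
constants satisfy `(b₁+b₂)/π ≤ 0.128` and
`(a₁+a₂)/π + ((b₁+b₂)/π) log(168π) ≤ 2.30 + 0.128 (log(168π) − log 2π)`, then
`|∫_{t₁}^{t₂} S(t) dt| ≤ 2.30 + 0.128 log(t₂/2π)` for all `168π < t₁ < t₂`
(`Literature.NumberTheory.LFunctions.abs_integral_zetaArgS_le_of_bounds` and monotonicity in `log t₂`).
[cite: EdwardsZeta1974, §8.2 (1)] -/
theorem abs_integral_zetaArgS_le_turing_of_bounds {a₁ b₁ a₂ b₂ : ℝ} (hb₁ : 0 ≤ b₁) (hb₂ : 0 ≤ b₂)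
    (hU : ∀ t : ℝ, 168 * π < t → (∀ ρ : ℂ, riemannZeta ρ = 0 → ρ.im ≠ t) →
      ∫ x in Ioi (1 / 2 : ℝ), Real.log ‖riemannZeta (x + t * I)‖ ≤ a₁ + b₁ * Real.log t)
    (hL : ∀ t : ℝ, 168 * π < t → (∀ ρ : ℂ, riemannZeta ρ = 0 → ρ.im ≠ t) →
      -(∫ x in Ioi (1 / 2 : ℝ), Real.log ‖riemannZeta (x + t * I)‖) ≤ a₂ + b₂ * Real.log t)
    (hb : (b₁ + b₂) / π ≤ 0.128)
    (ha : (a₁ + a₂) / π + (b₁ + b₂) / π * Real.log (168 * π) ≤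
      2.30 + 0.128 * (Real.log (168 * π) - Real.log (2 * π))) :
    abs_integral_zetaArgS_le_turing := by
  intro t₁ t₂ h₁ h12
  have hπ := Real.pi_pos
  have hπ3 := Real.pi_gt_three
  have ht₀ : (1 : ℝ) ≤ 168 * π := by nlinarith
  have h := abs_integral_zetaArgS_le_of_bounds ht₀ hb₁ hb₂ hU hL h₁ h12.le
  have ht₂ : 168 * π < t₂ := h₁.trans h12
  have ht₂0 : 0 < t₂ := lt_trans (by positivity) ht₂
  have hlog : Real.log (168 * π) ≤ Real.log t₂ := Real.log_le_log (by positivity) ht₂.le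
  have hdiv : Real.log (t₂ / (2 * π)) = Real.log t₂ - Real.log (2 * π) :=
    Real.log_div ht₂0.ne' (by positivity)
  rw [hdiv]
  have hcoef : 0 ≤ 0.128 - (b₁ + b₂) / π := by linarith
  nlinarith [mul_le_mul_of_nonneg_left hlog hcoef]


/-! ### Numerics, I: elementary bounds for `ζ(σ)` and `∫ log ζ(σ) dσ` on the real axis -/

/-- **Integral test, upper bound**: for real `σ > 1` and `N ≥ 1`,
`ζ(σ) ≤ Σ_{n≤N} n^{-σ} + N^{1−σ}/(σ−1)`. [folklore] -/
theorem re_riemannZeta_ofReal_le_sum_add {σ : ℝ} (hσ : 1 < σ) {N : ℕ} (hN : 1 ≤ N) :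
    (riemannZeta σ).re ≤
      (∑ n ∈ Finset.range N, ((n : ℝ) + 1) ^ (-σ)) + (N : ℝ) ^ (1 - σ) / (σ - 1) := by
  have hsum := summable_nat_add_one_rpow_neg hσ
  rw [re_riemannZeta_ofReal_eq_tsum hσ, ← hsum.sum_add_tsum_nat_add N]
  gcongr
  -- the tail `Σ_{i} (i + N + 1)^{-σ} ≤ ∫_N^∞ x^{-σ} dx`
  have hN0 : (0 : ℝ) < N := by exact_mod_cast hN
  have hanti : AntitoneOn (fun x : ℝ ↦ x ^ (-σ)) (Ici (N : ℝ)) :=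
    (Real.antitoneOn_rpow_Ioi_of_exponent_nonpos (by linarith)).mono
      (fun x hx ↦ lt_of_lt_of_le hN0 hx)
  have hint : IntegrableOn (fun x : ℝ ↦ x ^ (-σ)) (Ioi (N : ℝ)) :=
    integrableOn_Ioi_rpow_of_lt (by linarith) hN0
  have h := hanti.tsum_comp_add_le_integral N hint (fun x hx ↦ Real.rpow_nonneg (hN0.le.trans (le_of_lt hx)) _)
  have hI : ∫ x in Ioi (N : ℝ), x ^ (-σ) = (N : ℝ) ^ (1 - σ) / (σ - 1) := by
    rw [integral_Ioi_rpow_of_lt (by linarith) hN0, show -σ + 1 = 1 - σ by ring]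
    rw [neg_div, ← div_neg, show -(1 - σ) = σ - 1 by ring]
  rw [hI] at h
  have e : (fun i : ℕ ↦ (((i + N : ℕ) : ℝ) + 1) ^ (-σ)) = fun n : ℕ ↦ ((n + N + 1 : ℕ) : ℝ) ^ (-σ) := by
    funext i; push_cast; ring_nf
  rw [e]; exact h

/-- **Integral test, lower bound**: for real `σ > 1` and any `N`,
`Σ_{n≤N} n^{-σ} + (N+1)^{1−σ}/(σ−1) ≤ ζ(σ)`. [folklore] -/
theorem sum_add_le_re_riemannZeta_ofReal {σ : ℝ} (hσ : 1 < σ) (N : ℕ) :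
    (∑ n ∈ Finset.range N, ((n : ℝ) + 1) ^ (-σ)) + ((N : ℝ) + 1) ^ (1 - σ) / (σ - 1) ≤
      (riemannZeta σ).re := by
  have hsum := summable_nat_add_one_rpow_neg hσ
  rw [re_riemannZeta_ofReal_eq_tsum hσ, ← hsum.sum_add_tsum_nat_add N]
  gcongr
  have hN0 : (0 : ℝ) < (N : ℝ) + 1 := by positivity
  have hN0' : (0 : ℝ) < ((N + 1 : ℕ) : ℝ) := by positivity
  have hanti : AntitoneOn (fun x : ℝ ↦ x ^ (-σ)) (Ici (((N + 1 : ℕ) : ℝ))) :=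
    (Real.antitoneOn_rpow_Ioi_of_exponent_nonpos (by linarith)).mono
      (fun x hx ↦ lt_of_lt_of_le hN0' (show ((N + 1 : ℕ) : ℝ) ≤ x from hx))
  have hsum' : Summable fun n : ℕ ↦ (n : ℝ) ^ (-σ) :=
    (Real.summable_nat_rpow (p := -σ)).2 (by linarith)
  have h := hanti.integral_le_tsum_comp_add (N + 1) hsum'
    (fun x hx ↦ Real.rpow_nonneg ((by positivity : (0:ℝ) ≤ ((N + 1 : ℕ) : ℝ)).trans (le_of_lt hx)) _)
  have hI : ∫ x in Ioi (((N + 1 : ℕ) : ℝ)), x ^ (-σ) = ((N : ℝ) + 1) ^ (1 - σ) / (σ - 1) := by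
    push_cast
    rw [integral_Ioi_rpow_of_lt (by linarith) hN0, show -σ + 1 = 1 - σ by ring]
    rw [neg_div, ← div_neg, show -(1 - σ) = σ - 1 by ring]
  rw [hI] at h
  have e : (fun i : ℕ ↦ (((i + N : ℕ) : ℝ) + 1) ^ (-σ)) = fun n : ℕ ↦ ((n + (N + 1) : ℕ) : ℝ) ^ (-σ) := by
    funext i; push_cast; ring_nf
  rw [e]; exact h

/-- **Trapezoid rule for the convex function `log ζ(σ)`**: for `1 < a ≤ b`,
`∫_a^b log ζ(σ) dσ ≤ (b − a)(log ζ(a) + log ζ(b))/2`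
(`Literature.NumberTheory.LFunctions.convexOn_log_re_riemannZeta`). [folklore] -/
theorem intervalIntegral_log_norm_riemannZeta_ofReal_le_trapezoid {a b : ℝ} (ha : 1 < a)
    (hab : a ≤ b) :
    ∫ σ in a..b, Real.log ‖riemannZeta σ‖ ≤
      (b - a) * (Real.log ‖riemannZeta a‖ + Real.log ‖riemannZeta b‖) / 2 := by
  rcases hab.eq_or_lt with rfl | hlt
  · simp
  set fa := Real.log ‖riemannZeta a‖ with hfa
  set fb := Real.log ‖riemannZeta b‖ with hfb
  set g : ℝ → ℝ := fun σ ↦ fa + (σ - a) / (b - a) * (fb - fa) with hg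
  have hba : 0 < b - a := by linarith
  have hint : IntervalIntegrable (fun σ : ℝ ↦ Real.log ‖riemannZeta σ‖) volume a b := by
    have h := integrableOn_log_norm_riemannZeta_ofReal (c := (1 + a) / 2) (by linarith)
    exact (h.mono_set (fun x hx ↦ by
      rw [uIcc_of_le hab] at hx; exact lt_of_lt_of_le (by linarith) hx.1)).intervalIntegrable
  have hgint : IntervalIntegrable g volume a b := by
    apply Continuous.intervalIntegrable; simp only [hg]; fun_prop
  have hmono : ∫ σ in a..b, Real.log ‖riemannZeta σ‖ ≤ ∫ σ in a..b, g σ := by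
    refine intervalIntegral.integral_mono_on hab hint hgint fun σ hσ ↦ ?_
    have hσ1 : 1 < σ := lt_of_lt_of_le ha hσ.1
    set l : ℝ := (σ - a) / (b - a) with hl
    have hl0 : 0 ≤ l := div_nonneg (by linarith [hσ.1]) hba.le
    have hl1 : l ≤ 1 := by rw [hl, div_le_one hba]; linarith [hσ.2]
    have hconv := convexOn_log_re_riemannZeta.2 (show (1 : ℝ) < a from ha) (show (1 : ℝ) < b by linarith)
      (show 0 ≤ 1 - l by linarith) hl0 (by ring)
    have hσeq : (1 - l) • a + l • b = σ := by
      simp only [smul_eq_mul, hl]; field_simp; ring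
    rw [hσeq] at hconv
    simp only [smul_eq_mul] at hconv
    rw [norm_riemannZeta_ofReal_eq_re hσ1]
    simp only [hg, hfa, hfb, norm_riemannZeta_ofReal_eq_re ha, norm_riemannZeta_ofReal_eq_re (show (1:ℝ) < b by linarith)]
    rw [← hl]
    linarith
  have hgval : ∫ σ in a..b, g σ = (b - a) * (fa + fb) / 2 := by
    simp only [hg]
    have h1 : IntervalIntegrable (fun _ : ℝ ↦ fa) volume a b := intervalIntegrable_const
    have h2 : IntervalIntegrable (fun σ : ℝ ↦ (σ - a) / (b - a) * (fb - fa)) volume a b :=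
      Continuous.intervalIntegrable (by fun_prop) _ _
    have h3 : IntervalIntegrable (fun σ : ℝ ↦ σ) volume a b := continuous_id.intervalIntegrable _ _
    have h4 : IntervalIntegrable (fun _ : ℝ ↦ a) volume a b := intervalIntegrable_const
    rw [intervalIntegral.integral_add h1 h2, intervalIntegral.integral_const, smul_eq_mul,
      intervalIntegral.integral_mul_const, intervalIntegral.integral_div,
      intervalIntegral.integral_sub h3 h4, integral_id, intervalIntegral.integral_const, smul_eq_mul]
    field_simp
    ring
  linarith

/-- **Tail of `∫ log ζ`**: for `σ₁ ≥ 2`, `∫_{σ₁}^∞ log ζ(σ) dσ ≤ (1 + 2/(σ₁−1)) 2^{−σ₁}/log 2`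
(`log ζ ≤ ζ − 1 ≤ 2^{−σ} + 2^{1−σ}/(σ−1)`). [folklore] -/
theorem setIntegral_Ioi_log_norm_riemannZeta_ofReal_le_tail {σ₁ : ℝ} (hσ₁ : 2 ≤ σ₁) :
    ∫ σ in Ioi σ₁, Real.log ‖riemannZeta σ‖ ≤
      (1 + 2 / (σ₁ - 1)) * (2 : ℝ) ^ (-σ₁) / Real.log 2 := by
  have hl2 : 0 < Real.log 2 := Real.log_pos one_lt_two
  set C : ℝ := 1 + 2 / (σ₁ - 1) with hC
  have hσ10 : 0 < σ₁ - 1 := by linarith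
  have hC0 : 0 ≤ C := by rw [hC]; positivity
  have h2exp : ∀ σ : ℝ, (2 : ℝ) ^ (-σ) = Real.exp (-Real.log 2 * σ) := fun σ ↦ by
    rw [Real.rpow_def_of_pos two_pos]; ring_nf
  have hpt : ∀ σ ∈ Ioi σ₁, Real.log ‖riemannZeta σ‖ ≤ C * Real.exp (-Real.log 2 * σ) := by
    intro σ hσ
    have hσ' : σ₁ < σ := hσ
    have hσ1 : 1 < σ := by linarith
    rw [norm_riemannZeta_ofReal_eq_re hσ1, ← h2exp]
    have hpos := riemannZeta_re_pos_of_one_lt hσ1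
    have hle := re_riemannZeta_ofReal_le_sum_add hσ1 (N := 2) (by norm_num)
    have hsum : ∑ n ∈ Finset.range 2, ((n : ℝ) + 1) ^ (-σ) = 1 + (2 : ℝ) ^ (-σ) := by
      simp only [Finset.sum_range_succ, Finset.sum_range_zero]; norm_num
    rw [hsum] at hle
    push_cast at hle
    have h21 : (2 : ℝ) ^ (1 - σ) = 2 * (2 : ℝ) ^ (-σ) := by
      rw [show (1 : ℝ) - σ = 1 + (-σ) by ring, Real.rpow_add two_pos, Real.rpow_one]
    have hlog : Real.log (riemannZeta σ).re ≤ (riemannZeta σ).re - 1 :=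
      Real.log_le_sub_one_of_pos hpos
    have h2σ : 0 ≤ (2 : ℝ) ^ (-σ) := Real.rpow_nonneg zero_le_two _
    have hfrac : (2 : ℝ) ^ (1 - σ) / (σ - 1) ≤ 2 * (2 : ℝ) ^ (-σ) / (σ₁ - 1) := by
      rw [h21]
      exact div_le_div_of_nonneg_left (by positivity) (by linarith) (by linarith)
    calc Real.log (riemannZeta σ).re ≤ (riemannZeta σ).re - 1 := hlog
      _ ≤ (2 : ℝ) ^ (-σ) + (2 : ℝ) ^ (1 - σ) / (σ - 1) := by linarith
      _ ≤ (2 : ℝ) ^ (-σ) + 2 * (2 : ℝ) ^ (-σ) / (σ₁ - 1) := by linarith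
      _ = C * (2 : ℝ) ^ (-σ) := by rw [hC]; field_simp
  have hint := integrableOn_log_norm_riemannZeta_ofReal (c := σ₁) (by linarith)
  have hint2 : IntegrableOn (fun σ : ℝ ↦ C * Real.exp (-Real.log 2 * σ)) (Ioi σ₁) :=
    (exp_neg_integrableOn_Ioi σ₁ hl2).const_mul C
  calc ∫ σ in Ioi σ₁, Real.log ‖riemannZeta σ‖
      ≤ ∫ σ in Ioi σ₁, C * Real.exp (-Real.log 2 * σ) :=
        setIntegral_mono_on hint hint2 measurableSet_Ioi hpt
    _ = C * (2 : ℝ) ^ (-σ₁) / Real.log 2 := by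
        rw [MeasureTheory.integral_const_mul, integral_exp_mul_Ioi (by linarith) σ₁, h2exp]
        field_simp

/-- Splitting `∫_a^∞ = ∫_a^b + ∫_b^∞` for `σ ↦ log ζ(σ)`, `1 < a ≤ b`. [folklore] -/
theorem setIntegral_Ioi_log_norm_riemannZeta_ofReal_eq_add {a b : ℝ} (ha : 1 < a) (hab : a ≤ b) :
    ∫ σ in Ioi a, Real.log ‖riemannZeta σ‖ =
      (∫ σ in a..b, Real.log ‖riemannZeta σ‖) + ∫ σ in Ioi b, Real.log ‖riemannZeta σ‖ := by
  have hI := integrableOn_log_norm_riemannZeta_ofReal ha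
  rw [← Ioc_union_Ioi_eq_Ioi hab,
    setIntegral_union (Ioc_disjoint_Ioi le_rfl) measurableSet_Ioi
      (hI.mono_set Ioc_subset_Ioi_self) (hI.mono_set (Ioi_subset_Ioi hab)),
    intervalIntegral.integral_of_le hab]

namespace TuringBound

/-! ### Numerics, II: rational bounds for powers and logarithms -/

/-- Upper bound for `b^{−σ}` from integer arithmetic: if `σ m = k` and `1 ≤ r^m b^k` then
`b^{−σ} ≤ r` (`b > 0`, `r ≥ 0`, `m ≥ 1`). [folklore] -/
theorem rpow_neg_le_of_one_le_pow_mul_pow {b r σ : ℝ} (hb : 0 < b) (hr : 0 ≤ r) {m k : ℕ}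
    (hm : m ≠ 0) (hσ : σ * m = k) (h : 1 ≤ r ^ m * b ^ k) : b ^ (-σ) ≤ r := by
  have hpow : (b ^ (-σ)) ^ m = (b ^ k)⁻¹ := by
    rw [← Real.rpow_natCast _ m, ← Real.rpow_mul hb.le, show -σ * (m : ℝ) = -(k : ℝ) by
      rw [← hσ]; ring, Real.rpow_neg hb.le, Real.rpow_natCast]
  rw [← pow_le_pow_iff_left₀ (Real.rpow_nonneg hb.le _) hr hm, hpow,
    inv_le_iff_one_le_mul₀ (pow_pos hb k)]
  linarith [mul_comm (r ^ m) (b ^ k)]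

/-- Lower bound for `b^{−σ}` from integer arithmetic: if `σ m = k` and `r^m b^k ≤ 1` then
`r ≤ b^{−σ}` (`b > 0`, `r ≥ 0`, `m ≥ 1`). [folklore] -/
theorem le_rpow_neg_of_pow_mul_pow_le_one {b r σ : ℝ} (hb : 0 < b) (hr : 0 ≤ r) {m k : ℕ}
    (hm : m ≠ 0) (hσ : σ * m = k) (h : r ^ m * b ^ k ≤ 1) : r ≤ b ^ (-σ) := by
  have hpow : (b ^ (-σ)) ^ m = (b ^ k)⁻¹ := by
    rw [← Real.rpow_natCast _ m, ← Real.rpow_mul hb.le, show -σ * (m : ℝ) = -(k : ℝ) by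
      rw [← hσ]; ring, Real.rpow_neg hb.le, Real.rpow_natCast]
  rw [← pow_le_pow_iff_left₀ hr (Real.rpow_nonneg hb.le _) hm, hpow, ← one_div,
    le_div_iff₀ (pow_pos hb k)]
  exact h

/-- The four-term partial sum. [folklore] -/
theorem sum_range_four_rpow_neg (σ : ℝ) :
    ∑ n ∈ Finset.range 4, ((n : ℝ) + 1) ^ (-σ) =
      1 + (2 : ℝ) ^ (-σ) + (3 : ℝ) ^ (-σ) + (4 : ℝ) ^ (-σ) := by
  simp only [Finset.sum_range_succ, Finset.sum_range_zero]; norm_num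

/-! ### Numerics, III: values of `log ζ(σ)` at the nodes `σ = 3/2, 2, …, 5` -/

/-- `log ζ(3/2) ≤ 0.9825` (`ζ(3/2) ≤ 1 + 2^{-3/2} + 3^{-3/2} + 4^{-3/2} + 2·4^{-1/2} ≤ 2.671006`). [folklore] -/
theorem log_norm_riemannZeta_three_halves_le : Real.log ‖riemannZeta (3 / 2 : ℝ)‖ ≤ 0.9825 := by
  have hσ : (1 : ℝ) < 3 / 2 := by norm_num
  rw [norm_riemannZeta_ofReal_eq_re hσ]
  have hpos := riemannZeta_re_pos_of_one_lt hσ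
  have hB := re_riemannZeta_ofReal_le_sum_add hσ (N := 4) (by norm_num)
  rw [sum_range_four_rpow_neg] at hB
  have h2 : (2 : ℝ) ^ (-(3 / 2 : ℝ)) ≤ 0.353554 :=
    rpow_neg_le_of_one_le_pow_mul_pow two_pos (by norm_num) (m := 2) (k := 3) two_ne_zero
      (by norm_num) (by norm_num)
  have h3 : (3 : ℝ) ^ (-(3 / 2 : ℝ)) ≤ 0.192451 :=
    rpow_neg_le_of_one_le_pow_mul_pow (by norm_num) (by norm_num) (m := 2) (k := 3) two_ne_zero
      (by norm_num) (by norm_num)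
  have h4 : (4 : ℝ) ^ (-(3 / 2 : ℝ)) ≤ 0.125 :=
    rpow_neg_le_of_one_le_pow_mul_pow (by norm_num) (by norm_num) (m := 2) (k := 3) two_ne_zero
      (by norm_num) (by norm_num)
  have h4' : ((4 : ℕ) : ℝ) ^ (1 - (3 / 2 : ℝ)) / (3 / 2 - 1) ≤ 1 := by
    have : ((4 : ℕ) : ℝ) ^ (1 - (3 / 2 : ℝ)) ≤ 0.5 := by
      rw [show (1 : ℝ) - 3 / 2 = -(1 / 2) by norm_num]
      exact rpow_neg_le_of_one_le_pow_mul_pow (by norm_num) (by norm_num) (m := 2) (k := 1)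
        two_ne_zero (by norm_num) (by norm_num)
    rw [div_le_iff₀ (by norm_num)]; linarith
  have hre : (riemannZeta ((3 / 2 : ℝ) : ℂ)).re ≤ 2.671006 := by linarith
  exact (Real.log_le_iff_le_exp hpos).2 ((hre.trans (by norm_num [Finset.sum_range_succ,
      Nat.factorial])).trans (Real.sum_le_exp_of_nonneg (by norm_num) 12))

/-- `log ζ(5/2) ≤ 0.3042` (integral test with four terms). [folklore] -/
theorem log_norm_riemannZeta_five_halves_le : Real.log ‖riemannZeta (5 / 2 : ℝ)‖ ≤ 0.3042 := by
  have hσ : (1 : ℝ) < 5 / 2 := by norm_num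
  rw [norm_riemannZeta_ofReal_eq_re hσ]
  have hpos := riemannZeta_re_pos_of_one_lt hσ
  have hB := re_riemannZeta_ofReal_le_sum_add hσ (N := 4) (by norm_num)
  rw [sum_range_four_rpow_neg] at hB
  have h2 : (2 : ℝ) ^ (-(5 / 2 : ℝ)) ≤ 0.176777 :=
    rpow_neg_le_of_one_le_pow_mul_pow two_pos (by norm_num) (m := 2) (k := 5) two_ne_zero
      (by norm_num) (by norm_num)
  have h3 : (3 : ℝ) ^ (-(5 / 2 : ℝ)) ≤ 0.0641501 :=
    rpow_neg_le_of_one_le_pow_mul_pow (by norm_num) (by norm_num) (m := 2) (k := 5) two_ne_zero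
      (by norm_num) (by norm_num)
  have h4 : (4 : ℝ) ^ (-(5 / 2 : ℝ)) ≤ 0.03125 :=
    rpow_neg_le_of_one_le_pow_mul_pow (by norm_num) (by norm_num) (m := 2) (k := 5) two_ne_zero
      (by norm_num) (by norm_num)
  have h4' : ((4 : ℕ) : ℝ) ^ (1 - (5 / 2 : ℝ)) / (5 / 2 - 1) ≤ 1 / 12 := by
    have : ((4 : ℕ) : ℝ) ^ (1 - (5 / 2 : ℝ)) ≤ 0.125 := by
      rw [show (1 : ℝ) - 5 / 2 = -(3 / 2) by norm_num]
      exact rpow_neg_le_of_one_le_pow_mul_pow (by norm_num) (by norm_num) (m := 2) (k := 3)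
        two_ne_zero (by norm_num) (by norm_num)
    rw [div_le_iff₀ (by norm_num)]; linarith
  have hre : (riemannZeta ((5 / 2 : ℝ) : ℂ)).re ≤ 40665313 / 30000000 := by linarith
  exact (Real.log_le_iff_le_exp hpos).2 ((hre.trans (by norm_num [Finset.sum_range_succ,
      Nat.factorial])).trans (Real.sum_le_exp_of_nonneg (by norm_num) 12))

/-- `log ζ(3) ≤ 0.1898` (integral test with four terms). [folklore] -/
theorem log_norm_riemannZeta_three_le : Real.log ‖riemannZeta (3 : ℝ)‖ ≤ 0.1898 := by
  have hσ : (1 : ℝ) < 3 := by norm_num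
  rw [norm_riemannZeta_ofReal_eq_re hσ]
  have hpos := riemannZeta_re_pos_of_one_lt hσ
  have hB := re_riemannZeta_ofReal_le_sum_add hσ (N := 4) (by norm_num)
  rw [sum_range_four_rpow_neg] at hB
  have h2 : (2 : ℝ) ^ (-(3 : ℝ)) ≤ 0.125 :=
    rpow_neg_le_of_one_le_pow_mul_pow two_pos (by norm_num) (m := 1) (k := 3) one_ne_zero
      (by norm_num) (by norm_num)
  have h3 : (3 : ℝ) ^ (-(3 : ℝ)) ≤ 1 / 27 :=
    rpow_neg_le_of_one_le_pow_mul_pow (by norm_num) (by norm_num) (m := 1) (k := 3) one_ne_zero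
      (by norm_num) (by norm_num)
  have h4 : (4 : ℝ) ^ (-(3 : ℝ)) ≤ 0.015625 :=
    rpow_neg_le_of_one_le_pow_mul_pow (by norm_num) (by norm_num) (m := 1) (k := 3) one_ne_zero
      (by norm_num) (by norm_num)
  have h4' : ((4 : ℕ) : ℝ) ^ (1 - (3 : ℝ)) / (3 - 1) ≤ 0.03125 := by
    have : ((4 : ℕ) : ℝ) ^ (1 - (3 : ℝ)) ≤ 0.0625 := by
      rw [show (1 : ℝ) - 3 = -2 by norm_num]
      exact rpow_neg_le_of_one_le_pow_mul_pow (by norm_num) (by norm_num) (m := 1) (k := 2)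
        one_ne_zero (by norm_num) (by norm_num)
    rw [div_le_iff₀ (by norm_num)]; linarith
  have hre : (riemannZeta ((3 : ℝ) : ℂ)).re ≤ 2089 / 1728 := by linarith
  exact (Real.log_le_iff_le_exp hpos).2 ((hre.trans (by norm_num [Finset.sum_range_succ,
      Nat.factorial])).trans (Real.sum_le_exp_of_nonneg (by norm_num) 12))

/-- `log ζ(7/2) ≤ 0.1223` (integral test with four terms). [folklore] -/
theorem log_norm_riemannZeta_seven_halves_le : Real.log ‖riemannZeta (7 / 2 : ℝ)‖ ≤ 0.1223 := by
  have hσ : (1 : ℝ) < 7 / 2 := by norm_num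
  rw [norm_riemannZeta_ofReal_eq_re hσ]
  have hpos := riemannZeta_re_pos_of_one_lt hσ
  have hB := re_riemannZeta_ofReal_le_sum_add hσ (N := 4) (by norm_num)
  rw [sum_range_four_rpow_neg] at hB
  have h2 : (2 : ℝ) ^ (-(7 / 2 : ℝ)) ≤ 0.0883884 :=
    rpow_neg_le_of_one_le_pow_mul_pow two_pos (by norm_num) (m := 2) (k := 7) two_ne_zero
      (by norm_num) (by norm_num)
  have h3 : (3 : ℝ) ^ (-(7 / 2 : ℝ)) ≤ 0.0213834 :=
    rpow_neg_le_of_one_le_pow_mul_pow (by norm_num) (by norm_num) (m := 2) (k := 7) two_ne_zero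
      (by norm_num) (by norm_num)
  have h4 : (4 : ℝ) ^ (-(7 / 2 : ℝ)) ≤ 0.0078125 :=
    rpow_neg_le_of_one_le_pow_mul_pow (by norm_num) (by norm_num) (m := 2) (k := 7) two_ne_zero
      (by norm_num) (by norm_num)
  have h4' : ((4 : ℕ) : ℝ) ^ (1 - (7 / 2 : ℝ)) / (7 / 2 - 1) ≤ 0.0125 := by
    have : ((4 : ℕ) : ℝ) ^ (1 - (7 / 2 : ℝ)) ≤ 0.03125 := by
      rw [show (1 : ℝ) - 7 / 2 = -(5 / 2) by norm_num]
      exact rpow_neg_le_of_one_le_pow_mul_pow (by norm_num) (by norm_num) (m := 2) (k := 5)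
        two_ne_zero (by norm_num) (by norm_num)
    rw [div_le_iff₀ (by norm_num)]; linarith
  have hre : (riemannZeta ((7 / 2 : ℝ) : ℂ)).re ≤ 1.1300843 := by linarith
  exact (Real.log_le_iff_le_exp hpos).2 ((hre.trans (by norm_num [Finset.sum_range_succ,
      Nat.factorial])).trans (Real.sum_le_exp_of_nonneg (by norm_num) 12))

/-- `log ζ(9/2) ≤ 0.0541` (integral test with four terms). [folklore] -/
theorem log_norm_riemannZeta_nine_halves_le : Real.log ‖riemannZeta (9 / 2 : ℝ)‖ ≤ 0.0541 := by
  have hσ : (1 : ℝ) < 9 / 2 := by norm_num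
  rw [norm_riemannZeta_ofReal_eq_re hσ]
  have hpos := riemannZeta_re_pos_of_one_lt hσ
  have hB := re_riemannZeta_ofReal_le_sum_add hσ (N := 4) (by norm_num)
  rw [sum_range_four_rpow_neg] at hB
  have h2 : (2 : ℝ) ^ (-(9 / 2 : ℝ)) ≤ 0.0441942 :=
    rpow_neg_le_of_one_le_pow_mul_pow two_pos (by norm_num) (m := 2) (k := 9) two_ne_zero
      (by norm_num) (by norm_num)
  have h3 : (3 : ℝ) ^ (-(9 / 2 : ℝ)) ≤ 0.0071279 :=
    rpow_neg_le_of_one_le_pow_mul_pow (by norm_num) (by norm_num) (m := 2) (k := 9) two_ne_zero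
      (by norm_num) (by norm_num)
  have h4 : (4 : ℝ) ^ (-(9 / 2 : ℝ)) ≤ 0.001953125 :=
    rpow_neg_le_of_one_le_pow_mul_pow (by norm_num) (by norm_num) (m := 2) (k := 9) two_ne_zero
      (by norm_num) (by norm_num)
  have h4' : ((4 : ℕ) : ℝ) ^ (1 - (9 / 2 : ℝ)) / (9 / 2 - 1) ≤ 1 / 448 := by
    have : ((4 : ℕ) : ℝ) ^ (1 - (9 / 2 : ℝ)) ≤ 0.0078125 := by
      rw [show (1 : ℝ) - 9 / 2 = -(7 / 2) by norm_num]
      exact rpow_neg_le_of_one_le_pow_mul_pow (by norm_num) (by norm_num) (m := 2) (k := 7)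
        two_ne_zero (by norm_num) (by norm_num)
    rw [div_le_iff₀ (by norm_num)]; linarith
  have hre : (riemannZeta ((9 / 2 : ℝ) : ℂ)).re ≤ 295542063 / 280000000 := by linarith
  exact (Real.log_le_iff_le_exp hpos).2 ((hre.trans (by norm_num [Finset.sum_range_succ,
      Nat.factorial])).trans (Real.sum_le_exp_of_nonneg (by norm_num) 12))

/-- `log ζ(5) ≤ 0.0367` (integral test with four terms). [folklore] -/
theorem log_norm_riemannZeta_five_le : Real.log ‖riemannZeta (5 : ℝ)‖ ≤ 0.0367 := by
  have hσ : (1 : ℝ) < 5 := by norm_num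
  rw [norm_riemannZeta_ofReal_eq_re hσ]
  have hpos := riemannZeta_re_pos_of_one_lt hσ
  have hB := re_riemannZeta_ofReal_le_sum_add hσ (N := 4) (by norm_num)
  rw [sum_range_four_rpow_neg] at hB
  have h2 : (2 : ℝ) ^ (-(5 : ℝ)) ≤ 0.03125 :=
    rpow_neg_le_of_one_le_pow_mul_pow two_pos (by norm_num) (m := 1) (k := 5) one_ne_zero
      (by norm_num) (by norm_num)
  have h3 : (3 : ℝ) ^ (-(5 : ℝ)) ≤ 1 / 243 :=
    rpow_neg_le_of_one_le_pow_mul_pow (by norm_num) (by norm_num) (m := 1) (k := 5) one_ne_zero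
      (by norm_num) (by norm_num)
  have h4 : (4 : ℝ) ^ (-(5 : ℝ)) ≤ 0.0009765625 :=
    rpow_neg_le_of_one_le_pow_mul_pow (by norm_num) (by norm_num) (m := 1) (k := 5) one_ne_zero
      (by norm_num) (by norm_num)
  have h4' : ((4 : ℕ) : ℝ) ^ (1 - (5 : ℝ)) / (5 - 1) ≤ 0.0009765625 := by
    have : ((4 : ℕ) : ℝ) ^ (1 - (5 : ℝ)) ≤ 0.00390625 := by
      rw [show (1 : ℝ) - 5 = -4 by norm_num]
      exact rpow_neg_le_of_one_le_pow_mul_pow (by norm_num) (by norm_num) (m := 1) (k := 4)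
        one_ne_zero (by norm_num) (by norm_num)
    rw [div_le_iff₀ (by norm_num)]; linarith
  have hre : (riemannZeta ((5 : ℝ) : ℂ)).re ≤ 129059 / 124416 := by linarith
  exact (Real.log_le_iff_le_exp hpos).2 ((hre.trans (by norm_num [Finset.sum_range_succ,
      Nat.factorial])).trans (Real.sum_le_exp_of_nonneg (by norm_num) 12))

/-- `log ζ(2) = log(π²/6) ≤ 0.4978`. [folklore] -/
theorem log_norm_riemannZeta_two_le : Real.log ‖riemannZeta ((2 : ℝ) : ℂ)‖ ≤ 0.4978 := by
  have hval : ‖riemannZeta ((2 : ℝ) : ℂ)‖ = π ^ 2 / 6 := by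
    rw [show ((2 : ℝ) : ℂ) = 2 by norm_num, riemannZeta_two,
      show (π : ℂ) ^ 2 / 6 = ((π ^ 2 / 6 : ℝ) : ℂ) by push_cast; ring, Complex.norm_real,
      Real.norm_of_nonneg (by positivity)]
  rw [hval]
  have hπ := Real.pi_lt_d4
  have hπ0 := Real.pi_pos
  have hle : π ^ 2 / 6 ≤ 1.644942 := by nlinarith
  exact (Real.log_le_iff_le_exp (by positivity)).2 ((hle.trans (by norm_num [Finset.sum_range_succ,
      Nat.factorial])).trans (Real.sum_le_exp_of_nonneg (by norm_num) 12))

/-- `log ζ(4) = log(π⁴/90) ≤ 0.0792`. [folklore] -/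
theorem log_norm_riemannZeta_four_le : Real.log ‖riemannZeta ((4 : ℝ) : ℂ)‖ ≤ 0.0792 := by
  have hval : ‖riemannZeta ((4 : ℝ) : ℂ)‖ = π ^ 4 / 90 := by
    rw [show ((4 : ℝ) : ℂ) = 4 by norm_num, riemannZeta_four,
      show (π : ℂ) ^ 4 / 90 = ((π ^ 4 / 90 : ℝ) : ℂ) by push_cast; ring, Complex.norm_real,
      Real.norm_of_nonneg (by positivity)]
  rw [hval]
  have hπ := Real.pi_lt_d4
  have hπ0 := Real.pi_pos
  have h2 : π ^ 2 ≤ 9.86966 := by nlinarith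
  have h20 : 0 ≤ π ^ 2 := sq_nonneg π
  have h4 : π ^ 4 ≤ 9.86966 ^ 2 := by nlinarith
  have hle : π ^ 4 / 90 ≤ 1.08234 := by linarith
  exact (Real.log_le_iff_le_exp (by positivity)).2 ((hle.trans (by norm_num [Finset.sum_range_succ,
      Nat.factorial])).trans (Real.sum_le_exp_of_nonneg (by norm_num) 12))

/-! ### Numerics, IV: `m(3/2) = ∫_{3/2}^∞ log ζ(σ) dσ ≤ 0.947` and the upper-bound constant -/

/-- **`∫_{3/2}^∞ log ζ(σ) dσ ≤ 0.947`** (trapezoids on the half-integers up to `5` for the convex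
`log ζ`, with the node values above, and the tail bound at `5`; the true value is `0.8825…`).
[folklore] -/
theorem setIntegral_Ioi_log_norm_riemannZeta_three_halves_le :
    ∫ σ in Ioi (3 / 2 : ℝ), Real.log ‖riemannZeta σ‖ ≤ 0.947 := by
  have hsplit := setIntegral_Ioi_log_norm_riemannZeta_ofReal_eq_add (a := 3 / 2) (b := 5)
    (by norm_num) (by norm_num)
  -- tail
  have htail : ∫ σ in Ioi (5 : ℝ), Real.log ‖riemannZeta σ‖ ≤ 0.0677 := by
    refine (setIntegral_Ioi_log_norm_riemannZeta_ofReal_le_tail (σ₁ := 5) (by norm_num)).trans ?_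
    have hl2 := Real.log_two_gt_d9
    have h25 : (2 : ℝ) ^ (-(5 : ℝ)) ≤ 1 / 32 :=
      rpow_neg_le_of_one_le_pow_mul_pow two_pos (by norm_num) (m := 1) (k := 5) one_ne_zero
        (by norm_num) (by norm_num)
    rw [div_le_iff₀ (by linarith)]
    have : (1 + 2 / (5 - 1)) * (2 : ℝ) ^ (-(5 : ℝ)) ≤ 3 / 64 := by
      have h0 : (0 : ℝ) ≤ 1 + 2 / (5 - 1) := by norm_num
      nlinarith
    nlinarith
  -- trapezoids
  have hf : ∀ a b : ℝ, 1 < a → 1 < b →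
      IntervalIntegrable (fun σ : ℝ ↦ Real.log ‖riemannZeta σ‖) volume a b :=
    fun a b ha hb ↦ intervalIntegrable_log_norm_riemannZeta_ofReal ha hb
  have T := fun (a b : ℝ) (ha : 1 < a) (hab : a ≤ b) ↦
    intervalIntegral_log_norm_riemannZeta_ofReal_le_trapezoid ha hab
  have e : ∫ σ in (3 / 2 : ℝ)..5, Real.log ‖riemannZeta σ‖ =
      (∫ σ in (3 / 2 : ℝ)..2, Real.log ‖riemannZeta σ‖) +
      (∫ σ in (2 : ℝ)..(5 / 2), Real.log ‖riemannZeta σ‖) +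
      (∫ σ in (5 / 2 : ℝ)..3, Real.log ‖riemannZeta σ‖) +
      (∫ σ in (3 : ℝ)..(7 / 2), Real.log ‖riemannZeta σ‖) +
      (∫ σ in (7 / 2 : ℝ)..4, Real.log ‖riemannZeta σ‖) +
      (∫ σ in (4 : ℝ)..(9 / 2), Real.log ‖riemannZeta σ‖) +
      (∫ σ in (9 / 2 : ℝ)..5, Real.log ‖riemannZeta σ‖) := by
    rw [intervalIntegral.integral_add_adjacent_intervals (hf _ _ (by norm_num) (by norm_num))
        (hf _ _ (by norm_num) (by norm_num)),
      intervalIntegral.integral_add_adjacent_intervals (hf _ _ (by norm_num) (by norm_num))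
        (hf _ _ (by norm_num) (by norm_num)),
      intervalIntegral.integral_add_adjacent_intervals (hf _ _ (by norm_num) (by norm_num))
        (hf _ _ (by norm_num) (by norm_num)),
      intervalIntegral.integral_add_adjacent_intervals (hf _ _ (by norm_num) (by norm_num))
        (hf _ _ (by norm_num) (by norm_num)),
      intervalIntegral.integral_add_adjacent_intervals (hf _ _ (by norm_num) (by norm_num))
        (hf _ _ (by norm_num) (by norm_num)),
      intervalIntegral.integral_add_adjacent_intervals (hf _ _ (by norm_num) (by norm_num))
        (hf _ _ (by norm_num) (by norm_num))]
  have h1 := T (3 / 2) 2 (by norm_num) (by norm_num)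
  have h2 := T 2 (5 / 2) (by norm_num) (by norm_num)
  have h3 := T (5 / 2) 3 (by norm_num) (by norm_num)
  have h4 := T 3 (7 / 2) (by norm_num) (by norm_num)
  have h5 := T (7 / 2) 4 (by norm_num) (by norm_num)
  have h6 := T 4 (9 / 2) (by norm_num) (by norm_num)
  have h7 := T (9 / 2) 5 (by norm_num) (by norm_num)
  have v1 := log_norm_riemannZeta_three_halves_le
  have v2 := log_norm_riemannZeta_two_le
  have v3 := log_norm_riemannZeta_five_halves_le
  have v4 := log_norm_riemannZeta_three_le
  have v5 := log_norm_riemannZeta_seven_halves_le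
  have v6 := log_norm_riemannZeta_four_le
  have v7 := log_norm_riemannZeta_nine_halves_le
  have v8 := log_norm_riemannZeta_five_le
  rw [hsplit, e]
  linarith

/-- `log ζ(5/4) ≤ 1.5431` (integral test with four terms; fourth roots certified by
`r⁴ bᵏ ≥ 1`). [folklore] -/
theorem log_norm_riemannZeta_five_quarters_le : Real.log ‖riemannZeta (5 / 4 : ℝ)‖ ≤ 1.5431 := by
  have hσ : (1 : ℝ) < 5 / 4 := by norm_num
  rw [norm_riemannZeta_ofReal_eq_re hσ]
  have hpos := riemannZeta_re_pos_of_one_lt hσ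
  have hB := re_riemannZeta_ofReal_le_sum_add hσ (N := 4) (by norm_num)
  rw [sum_range_four_rpow_neg] at hB
  have h2 : (2 : ℝ) ^ (-(5 / 4 : ℝ)) ≤ 0.420449 :=
    rpow_neg_le_of_one_le_pow_mul_pow two_pos (by norm_num) (m := 4) (k := 5) (by norm_num)
      (by norm_num) (by norm_num)
  have h3 : (3 : ℝ) ^ (-(5 / 4 : ℝ)) ≤ 0.253279 :=
    rpow_neg_le_of_one_le_pow_mul_pow (by norm_num) (by norm_num) (m := 4) (k := 5) (by norm_num)
      (by norm_num) (by norm_num)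
  have h4 : (4 : ℝ) ^ (-(5 / 4 : ℝ)) ≤ 0.176777 :=
    rpow_neg_le_of_one_le_pow_mul_pow (by norm_num) (by norm_num) (m := 4) (k := 5) (by norm_num)
      (by norm_num) (by norm_num)
  have h4' : ((4 : ℕ) : ℝ) ^ (1 - (5 / 4 : ℝ)) / (5 / 4 - 1) ≤ 2.828428 := by
    have : ((4 : ℕ) : ℝ) ^ (1 - (5 / 4 : ℝ)) ≤ 0.707107 := by
      rw [show (1 : ℝ) - 5 / 4 = -(1 / 4) by norm_num]
      exact rpow_neg_le_of_one_le_pow_mul_pow (by norm_num) (by norm_num) (m := 4) (k := 1)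
        (by norm_num) (by norm_num) (by norm_num)
    rw [div_le_iff₀ (by norm_num)]; linarith
  have hre : (riemannZeta ((5 / 4 : ℝ) : ℂ)).re ≤ 4.678933 := by linarith
  exact (Real.log_le_iff_le_exp hpos).2 ((hre.trans (by norm_num [Finset.sum_range_succ,
      Nat.factorial])).trans (Real.sum_le_exp_of_nonneg (by norm_num) 12))

/-- `log(4 ζ(5/4)) ≤ 2.9294` (`4 ζ(5/4) ≤ 18.715732`). [folklore] -/
theorem log_four_mul_re_riemannZeta_five_quarters_le :
    Real.log (4 * (riemannZeta (5 / 4 : ℝ)).re) ≤ 2.9294 := by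
  have hσ : (1 : ℝ) < 5 / 4 := by norm_num
  have hpos := riemannZeta_re_pos_of_one_lt hσ
  have hB := re_riemannZeta_ofReal_le_sum_add hσ (N := 4) (by norm_num)
  rw [sum_range_four_rpow_neg] at hB
  have h2 : (2 : ℝ) ^ (-(5 / 4 : ℝ)) ≤ 0.420449 :=
    rpow_neg_le_of_one_le_pow_mul_pow two_pos (by norm_num) (m := 4) (k := 5) (by norm_num)
      (by norm_num) (by norm_num)
  have h3 : (3 : ℝ) ^ (-(5 / 4 : ℝ)) ≤ 0.253279 :=
    rpow_neg_le_of_one_le_pow_mul_pow (by norm_num) (by norm_num) (m := 4) (k := 5) (by norm_num)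
      (by norm_num) (by norm_num)
  have h4 : (4 : ℝ) ^ (-(5 / 4 : ℝ)) ≤ 0.176777 :=
    rpow_neg_le_of_one_le_pow_mul_pow (by norm_num) (by norm_num) (m := 4) (k := 5) (by norm_num)
      (by norm_num) (by norm_num)
  have h4' : ((4 : ℕ) : ℝ) ^ (1 - (5 / 4 : ℝ)) / (5 / 4 - 1) ≤ 2.828428 := by
    have : ((4 : ℕ) : ℝ) ^ (1 - (5 / 4 : ℝ)) ≤ 0.707107 := by
      rw [show (1 : ℝ) - 5 / 4 = -(1 / 4) by norm_num]
      exact rpow_neg_le_of_one_le_pow_mul_pow (by norm_num) (by norm_num) (m := 4) (k := 1)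
        (by norm_num) (by norm_num) (by norm_num)
    rw [div_le_iff₀ (by norm_num)]; linarith
  have hre : 4 * (riemannZeta ((5 / 4 : ℝ) : ℂ)).re ≤ 18.715732 := by linarith
  exact (Real.log_le_iff_le_exp (by positivity)).2 ((hre.trans (by norm_num [Finset.sum_range_succ,
      Nat.factorial])).trans (Real.sum_le_exp_of_nonneg (by norm_num) 16))

/-- **`∫_{5/4}^∞ log ζ(σ) dσ ≤ 1.263`** (one more trapezoid on `[5/4, 3/2]`; true value `1.1834…`).
[folklore] -/
theorem setIntegral_Ioi_log_norm_riemannZeta_five_quarters_le :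
    ∫ σ in Ioi (5 / 4 : ℝ), Real.log ‖riemannZeta σ‖ ≤ 1.263 := by
  rw [setIntegral_Ioi_log_norm_riemannZeta_ofReal_eq_add (a := 5 / 4) (b := 3 / 2)
    (by norm_num) (by norm_num)]
  have h1 := intervalIntegral_log_norm_riemannZeta_ofReal_le_trapezoid (a := 5 / 4) (b := 3 / 2)
    (by norm_num) (by norm_num)
  have v0 := log_norm_riemannZeta_five_quarters_le
  have v1 := log_norm_riemannZeta_three_halves_le
  have h2 := setIntegral_Ioi_log_norm_riemannZeta_three_halves_le
  linarith

/-- `∫_{3/2}^{5/2} log ζ(σ) dσ ≤ 0.5706` (two trapezoids). [folklore] -/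
theorem intervalIntegral_log_norm_riemannZeta_three_halves_five_halves_le :
    ∫ σ in (3 / 2 : ℝ)..(5 / 2), Real.log ‖riemannZeta σ‖ ≤ 0.5706 := by
  have hf : ∀ a b : ℝ, 1 < a → 1 < b →
      IntervalIntegrable (fun σ : ℝ ↦ Real.log ‖riemannZeta σ‖) volume a b :=
    fun a b ha hb ↦ intervalIntegrable_log_norm_riemannZeta_ofReal ha hb
  rw [← intervalIntegral.integral_add_adjacent_intervals (b := 2)
    (hf _ _ (by norm_num) (by norm_num)) (hf _ _ (by norm_num) (by norm_num))]
  have h1 := intervalIntegral_log_norm_riemannZeta_ofReal_le_trapezoid (a := 3 / 2) (b := 2)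
    (by norm_num) (by norm_num)
  have h2 := intervalIntegral_log_norm_riemannZeta_ofReal_le_trapezoid (a := 2) (b := 5 / 2)
    (by norm_num) (by norm_num)
  have v1 := log_norm_riemannZeta_three_halves_le
  have v2 := log_norm_riemannZeta_two_le
  have v3 := log_norm_riemannZeta_five_halves_le
  linarith

/-- `0 ≤ ∫_a^∞ log ζ(σ) dσ` for `a > 1` (`ζ(σ) ≥ 1`). [folklore] -/
theorem setIntegral_Ioi_log_norm_riemannZeta_ofReal_nonneg {a : ℝ} (ha : 1 < a) :
    0 ≤ ∫ σ in Ioi a, Real.log ‖riemannZeta σ‖ := by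
  refine setIntegral_nonneg measurableSet_Ioi fun σ hσ ↦ ?_
  have hσ1 : 1 < σ := lt_trans ha hσ
  rw [norm_riemannZeta_ofReal_eq_re hσ1]
  exact Real.log_nonneg (one_le_re_riemannZeta_ofReal hσ1)

/-- `0 ≤ ∫_a^b log ζ(σ) dσ` for `1 < a ≤ b`. [folklore] -/
theorem intervalIntegral_log_norm_riemannZeta_ofReal_nonneg {a b : ℝ} (ha : 1 < a) (hab : a ≤ b) :
    0 ≤ ∫ σ in a..b, Real.log ‖riemannZeta σ‖ := by
  refine intervalIntegral.integral_nonneg hab fun σ hσ ↦ ?_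
  have hσ1 : 1 < σ := lt_of_lt_of_le ha hσ.1
  rw [norm_riemannZeta_ofReal_eq_re hσ1]
  exact Real.log_nonneg (one_le_re_riemannZeta_ofReal hσ1)

/-- **The constant of the upper bound**: with `c = 5/4`, `t₀ = 168π` (and `K = 4`, `θ = ½`,
`Q = 10`) the constant term of
`Literature.NumberTheory.LFunctions.setIntegral_Ioi_half_log_norm_riemannZeta_le_turing` is
`≤ 2.362` (`m(5/4) ≤ 1.263`, `(3/8) log(4ζ(5/4)) ≤ 1.0986`, `(15/16)(45/4)²/(2(168π)²) ≤ 0.0003`).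
[folklore] -/
theorem turing_upper_constant_le :
    (∫ σ in Ioi (5 / 4 : ℝ), Real.log ‖riemannZeta σ‖) +
        (5 / 4 - 1 / 2) / 2 * Real.log (4 * (riemannZeta (5 / 4 : ℝ)).re) +
        (1 / 2 * ((5 / 4 - 1 / 2) / 2) + (5 / 4 - 1 / 2)) * ((10 + 5 / 4) ^ 2 / (2 * (168 * π) ^ 2))
      ≤ 2.362 := by
  have h1 := setIntegral_Ioi_log_norm_riemannZeta_five_quarters_le
  have h2 := log_four_mul_re_riemannZeta_five_quarters_le
  have hπ := Real.pi_gt_d2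
  have h3 : (10 + 5 / 4 : ℝ) ^ 2 / (2 * (168 * π) ^ 2) ≤ 0.00023 := by
    rw [div_le_iff₀ (by positivity)]
    nlinarith
  have e1 : ((5 / 4 - 1 / 2) / 2 : ℝ) = 3 / 8 := by norm_num
  rw [e1]
  have e2 : (1 / 2 * (3 / 8) + (5 / 4 - 1 / 2) : ℝ) = 15 / 16 := by norm_num
  rw [e2]
  linarith

/-! ### Numerics, V: `−ζ'(3/2)/ζ(3/2) ≤ 1.573` -/

/-- `log 3 ≤ 1.09865` (`log 3 = log 2 + log(3/2)`, `log(3/2) ≤ 0.4055`). [folklore] -/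
theorem log_three_le_d5 : Real.log 3 ≤ 1.09865 := by
  have h2 := Real.log_two_lt_d9
  have h15 : Real.log (3 / 2) ≤ 0.4055 :=
    (Real.log_le_iff_le_exp (by norm_num)).2 (le_trans (b := ∑ i ∈ Finset.range 12,
      (0.4055 : ℝ) ^ i / i.factorial) (by norm_num [Finset.sum_range_succ, Nat.factorial])
      (Real.sum_le_exp_of_nonneg (by norm_num) 12))
  have : Real.log 3 = Real.log 2 + Real.log (3 / 2) := by
    rw [← Real.log_mul (by norm_num) (by norm_num)]; norm_num
  rw [this]; linarith

/-- **`‖ζ'(3/2)‖ ≤ 4.035`** (`ζ'(s) = −Σ (log n) n^{-s}`; the terms `n = 2, 3` explicitly and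
`Σ_{n ≥ 4} (log n) n^{-3/2} ≤ ∫_3^∞ (log x) x^{-3/2} dx = 3^{-1/2}(2 log 3 + 4)`, the integrand being
decreasing on `[e^{2/3}, ∞)`; true value `3.9322…`). [folklore] -/
theorem norm_deriv_riemannZeta_three_halves_le : ‖deriv riemannZeta ((3 / 2 : ℝ) : ℂ)‖ ≤ 4.035 := by
  set s : ℂ := ((3 / 2 : ℝ) : ℂ) with hs
  have hsre : s.re = 3 / 2 := by simp [hs]
  have hs1 : 1 < s.re := by rw [hsre]; norm_num
  set t : ℕ → ℂ := LSeries.term (LSeries.logMul 1) s with ht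
  have hsm : Summable t :=
    LSeriesSummable_logMul_of_lt_re (by rw [LSeries.abscissaOfAbsConv_one]; exact_mod_cast hs1)
  have hderiv : deriv riemannZeta s = -∑' n, t n := by
    rw [deriv_riemannZeta_eq_neg_LSeries hs1, LSeries]
  -- the terms
  have hnorm : ∀ n : ℕ, n ≠ 0 → ‖t n‖ = Real.log n / (n : ℝ) ^ (3 / 2 : ℝ) := by
    intro n hn
    rw [ht, LSeries.norm_term_eq, if_neg hn, hsre]
    simp only [LSeries.logMul, Pi.one_apply, mul_one]
    rw [← Complex.natCast_log, Complex.norm_real, Real.norm_of_nonneg (Real.log_natCast_nonneg _)]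
  have ht0 : ‖t 0‖ = 0 := by rw [ht, LSeries.norm_term_eq, if_pos rfl]
  have ht1 : ‖t 1‖ = 0 := by rw [hnorm 1 one_ne_zero]; simp
  -- split off `n < 4`
  have hsmn : Summable fun n ↦ ‖t n‖ := hsm.norm
  have hsplit := (hsmn.sum_add_tsum_nat_add 4).symm
  rw [Finset.sum_range_succ, Finset.sum_range_succ, Finset.sum_range_succ, Finset.sum_range_succ,
    Finset.sum_range_zero, zero_add, ht0, zero_add, ht1, zero_add, hnorm 2 two_ne_zero,
    hnorm 3 (by norm_num)] at hsplit
  -- the tail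
  set g : ℝ → ℝ := fun x ↦ x ^ (-(1 / 2 : ℝ) - 1) * Real.log x with hg
  obtain ⟨hgint, hgval⟩ := integral_Ioi_rpow_neg_succ_mul_log (a := 1 / 2) (N := 3) (by norm_num)
    (by norm_num)
  have hg_eq : ∀ x : ℝ, 0 < x → g x = Real.log x / x ^ (3 / 2 : ℝ) := by
    intro x hx
    have e : x ^ (-(1 / 2 : ℝ) - 1) = (x ^ (3 / 2 : ℝ))⁻¹ := by
      rw [← Real.rpow_neg hx.le]; norm_num
    simp only [hg, e, inv_mul_eq_div]
  have hanti : AntitoneOn g (Ici ((3 : ℕ) : ℝ)) := by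
    have hA := Real.log_div_self_rpow_antitoneOn (a := 3 / 2) (by norm_num)
    intro x hx y hy hxy
    have hx3 : (3 : ℝ) ≤ x := by simpa using hx
    have hy3 : (3 : ℝ) ≤ y := by simpa using hy
    have he : Real.exp (3 / 2 : ℝ)⁻¹ ≤ 3 := by
      have := Real.exp_one_lt_d9
      have h23 : Real.exp (3 / 2 : ℝ)⁻¹ ≤ Real.exp 1 := Real.exp_le_exp.2 (by norm_num)
      linarith
    rw [hg_eq x (by linarith), hg_eq y (by linarith)]
    exact hA (show Real.exp (3 / 2 : ℝ)⁻¹ ≤ x from he.trans hx3)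
      (show Real.exp (3 / 2 : ℝ)⁻¹ ≤ y from he.trans hy3) hxy
  have hnonneg : ∀ x ∈ Ioi ((3 : ℕ) : ℝ), 0 ≤ g x := by
    intro x hx
    have hx3 : (3 : ℝ) < x := by simpa using hx
    rw [hg_eq x (by linarith)]
    exact div_nonneg (Real.log_nonneg (by linarith)) (Real.rpow_nonneg (by linarith) _)
  have hgint' : IntegrableOn g (Ioi ((3 : ℕ) : ℝ)) := by rw [Nat.cast_ofNat]; exact hgint
  have htail_le := hanti.tsum_comp_add_le_integral 3 hgint' hnonneg
  have htail_eq : (fun n : ℕ ↦ ‖t (n + 4)‖) = fun n : ℕ ↦ g ((n + 3 + 1 : ℕ) : ℝ) := by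
    funext n
    rw [hnorm (n + 4) (by omega), hg_eq _ (by positivity)]
  have hI : ∫ x in Ioi ((3 : ℕ) : ℝ), g x =
      (3 : ℝ) ^ (-(1 / 2 : ℝ)) * (Real.log 3 / (1 / 2) + 1 / (1 / 2) ^ 2) := by
    rw [Nat.cast_ofNat]; exact hgval
  rw [htail_eq] at hsplit
  rw [hI] at htail_le
  -- numerics
  have hl2 := Real.log_two_lt_d9
  have hl3 := log_three_le_d5
  have h2 : (2 : ℝ) ^ (-(3 / 2 : ℝ)) ≤ 0.353554 :=
    rpow_neg_le_of_one_le_pow_mul_pow two_pos (by norm_num) (m := 2) (k := 3) two_ne_zero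
      (by norm_num) (by norm_num)
  have h3 : (3 : ℝ) ^ (-(3 / 2 : ℝ)) ≤ 0.192451 :=
    rpow_neg_le_of_one_le_pow_mul_pow (by norm_num) (by norm_num) (m := 2) (k := 3) two_ne_zero
      (by norm_num) (by norm_num)
  have h3h : (3 : ℝ) ^ (-(1 / 2 : ℝ)) ≤ 0.577351 :=
    rpow_neg_le_of_one_le_pow_mul_pow (by norm_num) (by norm_num) (m := 2) (k := 1) two_ne_zero
      (by norm_num) (by norm_num)
  have e2 : Real.log (2 : ℕ) / ((2 : ℕ) : ℝ) ^ (3 / 2 : ℝ) = Real.log 2 * (2 : ℝ) ^ (-(3 / 2 : ℝ)) := by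
    push_cast; rw [Real.rpow_neg (by norm_num), div_eq_mul_inv]
  have e3 : Real.log (3 : ℕ) / ((3 : ℕ) : ℝ) ^ (3 / 2 : ℝ) = Real.log 3 * (3 : ℝ) ^ (-(3 / 2 : ℝ)) := by
    push_cast; rw [Real.rpow_neg (by norm_num), div_eq_mul_inv]
  rw [e2, e3] at hsplit
  have hl20 : 0 ≤ Real.log 2 := Real.log_nonneg (by norm_num)
  have hl30 : 0 ≤ Real.log 3 := Real.log_nonneg (by norm_num)
  have hA : Real.log 2 * (2 : ℝ) ^ (-(3 / 2 : ℝ)) ≤ 0.6931471808 * 0.353554 :=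
    mul_le_mul hl2.le h2 (Real.rpow_nonneg (by norm_num) _) (by norm_num)
  have hB : Real.log 3 * (3 : ℝ) ^ (-(3 / 2 : ℝ)) ≤ 1.09865 * 0.192451 :=
    mul_le_mul hl3 h3 (Real.rpow_nonneg (by norm_num) _) (by norm_num)
  have hC : (3 : ℝ) ^ (-(1 / 2 : ℝ)) * (Real.log 3 / (1 / 2) + 1 / (1 / 2) ^ 2) ≤
      0.577351 * (1.09865 / (1 / 2) + 1 / (1 / 2) ^ 2) :=
    mul_le_mul h3h (by linarith) (by positivity) (by norm_num)
  calc ‖deriv riemannZeta s‖ = ‖∑' n, t n‖ := by rw [hderiv, norm_neg]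
    _ ≤ ∑' n, ‖t n‖ := norm_tsum_le_tsum_norm hsmn
    _ ≤ 4.035 := by rw [hsplit]; linarith

/-- `ζ(3/2) ≥ 2.5654` (integral test from below). [folklore] -/
theorem re_riemannZeta_three_halves_ge : 2.5654 ≤ (riemannZeta (3 / 2 : ℝ)).re := by
  have hσ : (1 : ℝ) < 3 / 2 := by norm_num
  have hB := sum_add_le_re_riemannZeta_ofReal hσ 4
  rw [sum_range_four_rpow_neg] at hB
  have h2 : (0.353553 : ℝ) ≤ (2 : ℝ) ^ (-(3 / 2 : ℝ)) :=
    le_rpow_neg_of_pow_mul_pow_le_one two_pos (by norm_num) (m := 2) (k := 3) two_ne_zero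
      (by norm_num) (by norm_num)
  have h3 : (0.19245 : ℝ) ≤ (3 : ℝ) ^ (-(3 / 2 : ℝ)) :=
    le_rpow_neg_of_pow_mul_pow_le_one (by norm_num) (by norm_num) (m := 2) (k := 3) two_ne_zero
      (by norm_num) (by norm_num)
  have h4 : (0.125 : ℝ) ≤ (4 : ℝ) ^ (-(3 / 2 : ℝ)) :=
    le_rpow_neg_of_pow_mul_pow_le_one (by norm_num) (by norm_num) (m := 2) (k := 3) two_ne_zero
      (by norm_num) (by norm_num)
  have h5 : (0.894426 : ℝ) ≤ (((4 : ℕ) : ℝ) + 1) ^ (1 - (3 / 2 : ℝ)) / (3 / 2 - 1) := by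
    have : (0.447213 : ℝ) ≤ (((4 : ℕ) : ℝ) + 1) ^ (1 - (3 / 2 : ℝ)) := by
      rw [show (1 : ℝ) - 3 / 2 = -(1 / 2) by norm_num, show (((4 : ℕ) : ℝ) + 1) = 5 by norm_num]
      exact le_rpow_neg_of_pow_mul_pow_le_one (by norm_num) (by norm_num) (m := 2) (k := 1)
        two_ne_zero (by norm_num) (by norm_num)
    rw [le_div_iff₀ (by norm_num)]; linarith
  linarith

/-- **`−ζ'(3/2)/ζ(3/2) ≤ 1.573`** (true value `1.5052…`). [folklore] -/
theorem neg_logDeriv_riemannZeta_three_halves_le :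
    (-deriv riemannZeta ((3 / 2 : ℝ) : ℂ) / riemannZeta ((3 / 2 : ℝ) : ℂ)).re ≤ 1.573 := by
  have hσ : (1 : ℝ) < 3 / 2 := by norm_num
  have hpos := riemannZeta_re_pos_of_one_lt hσ
  have hζ := norm_riemannZeta_ofReal_eq_re hσ
  have h1 := norm_deriv_riemannZeta_three_halves_le
  have h2 := re_riemannZeta_three_halves_ge
  refine (Complex.re_le_norm _).trans ?_
  rw [norm_div, norm_neg, hζ, div_le_iff₀ hpos]
  nlinarith

/-! ### Numerics, VI: logarithms of `2π` and `168π` -/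

/-- `1.8378 ≤ log(2π)`. [folklore] -/
theorem le_log_two_pi : 1.8378 ≤ Real.log (2 * π) := by
  rw [Real.le_log_iff_exp_le (by positivity)]
  have h1 : Real.exp 1.8378 = Real.exp 1 * Real.exp 0.8378 := by
    rw [← Real.exp_add]; norm_num
  have he := Real.exp_one_lt_d9
  have hb := Real.exp_bound' (x := 0.8378) (by norm_num) (by norm_num) (n := 12) (by norm_num)
  have hb' : Real.exp 0.8378 ≤ 2.31133 :=
    hb.trans (by norm_num [Finset.sum_range_succ, Nat.factorial])
  have hπ := Real.pi_gt_d6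
  rw [h1]
  nlinarith [Real.exp_pos 1, Real.exp_pos 0.8378]

/-- `6.2686 ≤ log(168π)`. [folklore] -/
theorem le_log_one_six_eight_pi : 6.2686 ≤ Real.log (168 * π) := by
  rw [Real.le_log_iff_exp_le (by positivity)]
  have h1 : Real.exp 6.2686 = Real.exp 1 ^ 6 * Real.exp 0.2686 := by
    rw [← Real.exp_nat_mul, ← Real.exp_add]; norm_num
  have he := Real.exp_one_lt_d9
  have he0 := Real.exp_pos 1
  have hb := Real.exp_bound' (x := 0.2686) (by norm_num) (by norm_num) (n := 10) (by norm_num)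
  have hb' : Real.exp 0.2686 ≤ 1.308132 :=
    hb.trans (by norm_num [Finset.sum_range_succ, Nat.factorial])
  have hπ := Real.pi_gt_d6
  have h6 : Real.exp 1 ^ 6 ≤ 2.7182818286 ^ 6 := by gcongr
  rw [h1]
  nlinarith [Real.exp_pos 0.2686, pow_pos he0 6]

/-! ### Numerics, VII: the constants of the lower bound at `d = 1`, `t₀ = 168π` -/

/-- `−I(1) ≤ 1.5176` (`I(d)` = `Literature.NumberTheory.LFunctions.turingI`; the two subtracted
half-integrals are `≥ 0` and are dropped, `∫_{3/2}^∞ log ζ ≤ 0.947`, `∫_{3/2}^{5/2} log ζ ≤ 0.5706`).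
[cite: Trudgian2011, §2.2, definition of I(d)] -/
theorem neg_turingI_one_le : -turingI 1 ≤ 1.5176 := by
  unfold turingI
  show -(1 / 2 * (∫ σ in Ioi (1 + 2 * 1 : ℝ), Real.log ‖riemannZeta σ‖) -
      (∫ σ in Ioi (1 / 2 + 1 : ℝ), Real.log ‖riemannZeta σ‖) +
      1 / 2 * (∫ σ in (1 + 2 * 1 : ℝ)..(1 + 4 * 1), Real.log ‖riemannZeta σ‖) -
      ∫ σ in (1 / 2 + 1 : ℝ)..(1 / 2 + 2 * 1), Real.log ‖riemannZeta σ‖) ≤ 1.5176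
  have h1 : 0 ≤ ∫ σ in Ioi (1 + 2 * 1 : ℝ), Real.log ‖riemannZeta σ‖ :=
    setIntegral_Ioi_log_norm_riemannZeta_ofReal_nonneg (by norm_num)
  have h2 : ∫ σ in Ioi (1 / 2 + 1 : ℝ), Real.log ‖riemannZeta σ‖ ≤ 0.947 := by
    rw [show (1 / 2 + 1 : ℝ) = 3 / 2 by norm_num]
    exact setIntegral_Ioi_log_norm_riemannZeta_three_halves_le
  have h3 : 0 ≤ ∫ σ in (1 + 2 * 1 : ℝ)..(1 + 4 * 1), Real.log ‖riemannZeta σ‖ :=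
    intervalIntegral_log_norm_riemannZeta_ofReal_nonneg (by norm_num) (by norm_num)
  have h4 : ∫ σ in (1 / 2 + 1 : ℝ)..(1 / 2 + 2 * 1), Real.log ‖riemannZeta σ‖ ≤ 0.5706 := by
    rw [show (1 / 2 + 1 : ℝ) = 3 / 2 by norm_num, show (1 / 2 + 2 * 1 : ℝ) = 5 / 2 by norm_num]
    exact intervalIntegral_log_norm_riemannZeta_three_halves_five_halves_le
  set A := (∫ σ in Ioi (1 + 2 * 1 : ℝ), Real.log ‖riemannZeta σ‖) with hA
  set B := (∫ σ in Ioi (1 / 2 + 1 : ℝ), Real.log ‖riemannZeta σ‖) with hB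
  set C := (∫ σ in (1 + 2 * 1 : ℝ)..(1 + 4 * 1), Real.log ‖riemannZeta σ‖) with hC
  set D := (∫ σ in (1 / 2 + 1 : ℝ)..(1 / 2 + 2 * 1), Real.log ‖riemannZeta σ‖) with hD
  linarith

/-- `ε(168π) ≤ 0.0015` (`ε` = `Literature.NumberTheory.LFunctions.turingEps`). [folklore] -/
theorem turingEps_le_of_168pi : turingEps (168 * π) ≤ 0.0015 := by
  unfold turingEps
  have hπ := Real.pi_gt_three
  have e : π / (4 * (168 * π)) = 1 / 672 := by field_simp; ring
  have h : 3 / (2 * (168 * π) ^ 2) ≤ 0.00001 := by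
    rw [div_le_iff₀ (by positivity)]; nlinarith
  rw [e]; norm_num at h ⊢; linarith

/-- `ε'(168π) ≤ 0.00151` (`ε'` = `Literature.NumberTheory.LFunctions.turingEps'`). [folklore] -/
theorem turingEps'_le_of_168pi : turingEps' (168 * π) ≤ 0.00151 := by
  unfold turingEps'
  have hπ := Real.pi_gt_three
  have e : π / (4 * (168 * π)) = 1 / 672 := by field_simp; ring
  have h : 4 / (168 * π) ^ 2 ≤ 0.00002 := by
    rw [div_le_iff₀ (by positivity)]; nlinarith
  rw [e]; norm_num at h ⊢; linarith

/-- **`a₂(1, 168π) ≤ 3.348`** (`a₂` = `Literature.NumberTheory.LFunctions.trudgianA₂`: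
`log 4 (−ζ'/ζ(3/2) + ε') − (log 4 − 1)·½log 2π + ε − I(1)` with `−ζ'/ζ(3/2) ≤ 1.573`,
`½ log 2π ≥ 0.9189`, `−I(1) ≤ 1.5176`). [cite: Trudgian2011, Lemma 2.11] -/
theorem trudgianA₂_one_le : trudgianA₂ 1 (168 * π) ≤ 3.348 := by
  have hr : (-deriv riemannZeta ((1 / 2 + 1 : ℝ) : ℂ) / riemannZeta ((1 / 2 + 1 : ℝ) : ℂ)).re ≤
      1.573 := by
    rw [show (1 / 2 + 1 : ℝ) = 3 / 2 by norm_num]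
    exact neg_logDeriv_riemannZeta_three_halves_le
  have hI := neg_turingI_one_le
  have hε := turingEps_le_of_168pi
  have hε' := turingEps'_le_of_168pi
  have hl2 := Real.log_two_gt_d9
  have hl2' := Real.log_two_lt_d9
  have hlog4 : Real.log 4 = 2 * Real.log 2 := by
    rw [show (4 : ℝ) = 2 ^ 2 by norm_num, Real.log_pow]; norm_num
  have hL : 1.8378 ≤ Real.log 2 + Real.log π := by
    rw [← Real.log_mul (by norm_num) Real.pi_ne_zero]; exact le_log_two_pi
  have hprod : 0.3862943 * 0.9189 ≤ (Real.log 4 - 1) * (Real.log 2 / 2 + Real.log π / 2) :=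
    mul_le_mul (by linarith) (by linarith) (by norm_num) (by linarith)
  have hX : Real.log 4 * ((-deriv riemannZeta ((1 / 2 + 1 : ℝ) : ℂ) /
      riemannZeta ((1 / 2 + 1 : ℝ) : ℂ)).re + turingEps' (168 * π)) ≤ 1.3862944 * 1.57451 := by
    have h4 : Real.log 4 ≤ 1.3862944 := by linarith
    have h40 : 0 ≤ Real.log 4 := by linarith
    calc Real.log 4 * ((-deriv riemannZeta ((1 / 2 + 1 : ℝ) : ℂ) /
          riemannZeta ((1 / 2 + 1 : ℝ) : ℂ)).re + turingEps' (168 * π))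
        ≤ Real.log 4 * 1.57451 := mul_le_mul_of_nonneg_left (by linarith) h40
      _ ≤ 1.3862944 * 1.57451 := mul_le_mul_of_nonneg_right h4 (by norm_num)
  unfold trudgianA₂
  nlinarith

/-- `0 ≤ b₂(1)` and `b₂(1) ≤ 0.1931472` (`b₂(1) = (log 4 − 1)/2`). [cite: Trudgian2011, Lemma 2.11] -/
theorem trudgianB₂_one_bounds : 0 ≤ trudgianB₂ 1 ∧ trudgianB₂ 1 ≤ 0.1931472 := by
  have hl2 := Real.log_two_gt_d9
  have hl2' := Real.log_two_lt_d9
  have hlog4 : Real.log 4 = 2 * Real.log 2 := by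
    rw [show (4 : ℝ) = 2 ^ 2 by norm_num, Real.log_pow]; norm_num
  unfold trudgianB₂
  rw [hlog4]
  constructor <;> nlinarith

end TuringBound

/-! ### The discharge -/

/-- **Turing's theorem (Edwards §8.2 (1); Turing 1953, Thm 4; Lehman 1970, Thm 4)**: for
`168π < t₁ < t₂`, `|∫_{t₁}^{t₂} S(t) dt| ≤ 2.30 + 0.128 log(t₂/2π)` — discharge of the named fact
`Literature.NumberTheory.LFunctions.abs_integral_zetaArgS_le_turing`.  Proof: Turing's lemma and
the assembly `abs_integral_zetaArgS_le_turing_of_bounds` with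
(upper) `U(t) ≤ a₁ + (3/16) log t`, `a₁ ≤ 2.362`, from the all-`t` critical-line bound of exponent
`½` (`setIntegral_Ioi_half_log_norm_riemannZeta_le_turing`, `c = 5/4`), and
(lower) Trudgian's Lemma 2.11 at `d = 1` (`neg_setIntegral_Ioi_half_log_norm_riemannZeta_le'`,
with Booker's lemma `Trudgian2011_lemma_2_10_holds`), `a₂ ≤ 3.348`, `b₂ = (log 4 − 1)/2`:
`(3/16 + b₂)/π ≤ 0.1212 < 0.128` and `(a₁ + a₂)/π ≤ 1.818 < 2.30 − 0.128 log 2π = 2.0647…`.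
[cite: EdwardsZeta1974, §8.2 (1)] -/
theorem abs_integral_zetaArgS_le_turing_holds : abs_integral_zetaArgS_le_turing := by
  have hπ := Real.pi_pos
  have hπ3 := Real.pi_gt_three
  have hπ6 := Real.pi_gt_d6
  have ht₀ : (1 : ℝ) ≤ 168 * π := by linarith
  obtain ⟨hb₂0, hb₂⟩ := TuringBound.trudgianB₂_one_bounds
  refine abs_integral_zetaArgS_le_turing_of_bounds (by norm_num) hb₂0
    (fun t ht hord ↦ setIntegral_Ioi_half_log_norm_riemannZeta_le_turing (c := 5 / 4)
      (by norm_num) ht₀ ht hord)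
    (fun t ht hord ↦ neg_setIntegral_Ioi_half_log_norm_riemannZeta_le'
      Trudgian2011_lemma_2_10_holds (d := 1) (by norm_num) le_rfl ht₀ ht hord) ?_ ?_
  · -- `(b₁ + b₂)/π ≤ 0.128`
    rw [div_le_iff₀ hπ]
    norm_num
    linarith
  · -- `(a₁ + a₂)/π + ((b₁ + b₂)/π) log(168π) ≤ 2.30 + 0.128 (log(168π) − log 2π)`
    have ha₁ := TuringBound.turing_upper_constant_le
    have ha₂ := TuringBound.trudgianA₂_one_le
    have hl2π : Real.log (2 * π) ≤ 1.8379 := by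
      have hπ' := Real.pi_lt_d6
      have hle : 2 * π ≤ 6.283186 := by linarith
      exact (Real.log_le_iff_le_exp (by positivity)).2 ((hle.trans (by norm_num
        [Finset.sum_range_succ, Nat.factorial])).trans (Real.sum_le_exp_of_nonneg (by norm_num) 14))
    have hL₁ : 0 ≤ Real.log (168 * π) := Real.log_nonneg (by linarith)
    have hA : ((∫ σ in Ioi (5 / 4 : ℝ), Real.log ‖riemannZeta σ‖) +
        (5 / 4 - 1 / 2) / 2 * Real.log (4 * (riemannZeta (5 / 4 : ℝ)).re) +
        (1 / 2 * ((5 / 4 - 1 / 2) / 2) + (5 / 4 - 1 / 2)) * ((10 + 5 / 4) ^ 2 / (2 * (168 * π) ^ 2)) +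
        trudgianA₂ 1 (168 * π)) / π ≤ 1.818 := by
      rw [div_le_iff₀ hπ]; linarith
    have hB : (1 / 2 * ((5 / 4 - 1 / 2) / 2) + trudgianB₂ 1) / π ≤ 0.128 := by
      rw [div_le_iff₀ hπ]; norm_num; linarith
    nlinarith [mul_le_mul_of_nonneg_right hB hL₁]

end Literature.NumberTheory.LFunctions

end
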